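import Literature.AlgebraicGeometry.Resolution.CatenaryRings
import Literature.AlgebraicGeometry.Resolution.CohenMacaulayUnmixed
import Literature.AlgebraicGeometry.Resolution.RegularLocalRingsQuotient
import Mathlib.RingTheory.Ideal.MinimalPrime.Noetherian
import HarnessLib

/-!
# Cohen–Macaulay local rings are catenary; regular rings are universally catenary

Topic: `Literature/AlgebraicGeometry/Resolution`. The local input promised in
`CatenaryRings.lean`: a Noetherian local ring with a regular sequence in `𝔪` of length `dim R`
(a Cohen–Macaulay local ring; in particular a regular local ring, Matsumura Thm. 17.8) has all
its maximal chains of primes of length `dim R` (Stacks 00N9/0AAE; Matsumura Thm. 17.4), hence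
regular local rings are catenary and — with `isUniversallyCatenaryRing_of_isRegularRing` of
`CatenaryRings.lean` — **regular Noetherian rings are universally catenary** (Stacks 00NM with
00NQ; Matsumura Thms. 17.8, 17.9), the ingredient of Stacks 032C ("via the Cohen structure
theorem … complete local rings are universally catenary") used for `Stacks07QW_complete`.
Everything is PROVED from `CohenMacaulayUnmixed.lean` (unmixedness, cutting down via Rees),
`CatenaryRings.lean` (chain transport) and the tree's regular-local-ring files (Thm. 14.2
quotients `RegularLocalRingsQuotient.lean`, Serre's Thm. 19.3 `Matsumura1987_19_3_holds`).

## Content (namespace `Literature.AlgebraicGeometry.Resolution`)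

* `exists_ltSeries_tail` — the tail of a saturated chain (poset helper).
* `length_eq_of_isSaturatedChain_of_isRegular(_aux)` — **Stacks 00N9/0AAE** for rings with a
  regular sequence in `𝔪` of length `dim R`: saturated chains from a minimal prime to `𝔪` have
  length `dim R`.
* `exists_isRegular_length_eq_ringKrullDim(_aux)` — **Matsumura Thm. 17.8 / Stacks 00NQ**: a
  regular local ring has a regular sequence in `𝔪` of length `dim R`.
* `isCatenaryRing_of_isRegularLocalRing` — regular local rings are catenary (Matsumura
  Thm. 17.4 (ii) with 17.8).
* `isUniversallyCatenaryRing_of_isRegularRing'` — **regular rings are universally catenary**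
  (Stacks 00NM; Matsumura Thm. 17.9 for regular rings).

## Sources

* The Stacks Project, Algebra: Tags 0AAE, 00N9, 00NQ, 00NM; More on Algebra, Tag 07QW (proof).
  [StacksProject]
* H. Matsumura, *Commutative Ring Theory*, CUP 1986: Thm. 17.4, Thm. 17.8, Thm. 17.9
  [PDF 150–153]. [Matsumura1987]
-/

noncomputable section

open IsLocalRing RingTheory.Sequence
open scoped Pointwise

namespace Literature.AlgebraicGeometry.Resolution

universe u

section Poset

variable {α : Type*} [PartialOrder α]

/-- Dropping the first term of a saturated chain of positive length leaves a saturated chain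
from the second term to the last one. [folklore] -/
theorem exists_ltSeries_tail (s : LTSeries α) (h : s.length ≠ 0)
    (hs : ∀ i : Fin s.length, s i.castSucc ⋖ s i.succ) :
    ∃ t : LTSeries α, t.head = s ⟨1, by omega⟩ ∧ t.last = s.last ∧ t.length + 1 = s.length ∧
      ∀ i : Fin t.length, t i.castSucc ⋖ t i.succ := by
  obtain ⟨ℓ, hℓ⟩ := Nat.exists_eq_succ_of_ne_zero h
  refine ⟨LTSeries.mk ℓ (fun i => s ⟨i.1 + 1, by omega⟩) (fun i j hij =>
      s.strictMono (Fin.mk_lt_mk.mpr (Nat.succ_lt_succ (Fin.lt_def.mp hij)))), rfl, ?_,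
    (show ℓ + 1 = s.length by omega), fun i => ?_⟩
  · show s ⟨(Fin.last ℓ).1 + 1, _⟩ = s (Fin.last s.length)
    congr 1
    ext
    simp [hℓ]
  · have hi : (i : ℕ) < ℓ := i.2
    show s ⟨i.1 + 1, _⟩ ⋖ s ⟨i.1 + 1 + 1, _⟩
    exact hs ⟨i.1 + 1, by omega⟩

end Poset

/-! ## Maximal chains in local rings with a regular sequence of length `dim` -/

section Main

/-- **Stacks 00N9 / 0AAE for rings with a regular sequence of length `dim R`** (Cohen–Macaulay
local rings, Matsumura Thm. 17.4): in a Noetherian local ring `(R, 𝔪)` admitting a regular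
sequence in `𝔪` of length `d = dim R`, every saturated chain of primes from a minimal prime to
`𝔪` has length `d`. Printed proof (Stacks 0AAE): induction on `d`; take `x ∈ 𝔭₁` outside the
minimal primes (a non-zero-divisor by unmixedness), replace it by `xⁿ` so that `𝔭₁` becomes
associated to — hence, by unmixedness of `R/xⁿR` (which again has a regular sequence of length
`dim R/xⁿR = d - 1`), minimal over — `xⁿR`, and apply the induction hypothesis to the chain
`𝔭₁/xⁿ ⊂ ⋯ ⊂ 𝔪/xⁿ` in `R/xⁿR`. [cite: StacksProject, Tag 0AAE] -/
theorem length_eq_of_isSaturatedChain_of_isRegular_aux (d : ℕ) :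
    ∀ (R : Type u) [CommRing R] [IsLocalRing R] [IsNoetherianRing R] (rs : List R),
      IsRegular R rs → (∀ r ∈ rs, r ∈ maximalIdeal R) → rs.length = d →
      (rs.length : WithBot ℕ∞) = ringKrullDim R →
      ∀ s : LTSeries (PrimeSpectrum R), s.head.asIdeal ∈ minimalPrimes R →
        s.last = IsLocalRing.closedPoint R → IsSaturatedChain s → s.length = d := by
  induction d with
  | zero =>
    intro R _ _ _ rs hrs hmem hlen hdim s hhead hlast hs
    have h1 : (s.length : WithBot ℕ∞) ≤ ringKrullDim R := Order.LTSeries.length_le_krullDim s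
    rw [← hdim, hlen] at h1
    have : s.length ≤ 0 := by exact_mod_cast h1
    omega
  | succ d ih =>
    intro R _ _ _ rs hrs hmem hlen hdim s hhead hlast hs
    -- (i) the chain has positive length
    have hlen0 : s.length ≠ 0 := by
      intro h0
      have hhl : s.head = s.last := by
        simp only [RelSeries.head, RelSeries.last]
        congr 1
        ext
        simp [h0]
      rw [hhl, hlast] at hhead
      have h1 : (maximalIdeal R).height = 0 := Ideal.height_eq_zero_iff.mpr hhead
      have h2 := IsLocalRing.maximalIdeal_height_eq_ringKrullDim (R := R)
      rw [h1, ← hdim, hlen] at h2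
      have : (0 : ℕ) = d + 1 := by exact_mod_cast h2
      omega
    -- (ii) the tail `𝔭₁ ⊂ ⋯ ⊂ 𝔪` and the cover `𝔭₀ ⋖ 𝔭₁`
    obtain ⟨t, hthead, htlast, htlen, ht⟩ := exists_ltSeries_tail s hlen0 hs
    have hcov : s.head ⋖ t.head := by
      have h1 : s ⟨0, by omega⟩ ⋖ s ⟨0 + 1, by omega⟩ := hs ⟨0, by omega⟩
      have h2 : s.head = s ⟨0, by omega⟩ := congrArg s (Fin.ext (by simp))
      rw [hthead, h2]
      exact h1
    -- (iii) `𝔭₁` lies in no minimal prime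
    have hp1_not_le : ∀ q ∈ minimalPrimes R, ¬ t.head.asIdeal ≤ q := by
      intro q hq hle
      have hQmin : IsMin (⟨q, hq.1.1⟩ : PrimeSpectrum R) := PrimeSpectrum.isMin_iff.mpr hq
      have hle' : t.head ≤ ⟨q, hq.1.1⟩ := hle
      have h2 : (⟨q, hq.1.1⟩ : PrimeSpectrum R) ≤ s.head := hQmin (hcov.lt.le.trans hle')
      exact lt_irrefl _ ((hcov.lt.trans_le hle').trans_le h2)
    -- (iv) `x ∈ 𝔭₁` outside all minimal primes (prime avoidance)
    have hfin : (minimalPrimes R).Finite := minimalPrimes.finite_of_isNoetherianRing R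
    obtain ⟨x, hxp1, hxmin⟩ : ∃ x ∈ t.head.asIdeal, ∀ q ∈ minimalPrimes R, x ∉ q := by
      by_contra! hcon
      have hsub : ((t.head.asIdeal : Ideal R) : Set R) ⊆ ⋃ q ∈ minimalPrimes R, ((id q : Ideal R) : Set R) := by
        intro z hz
        obtain ⟨q, hq, hzq⟩ := hcon z hz
        exact Set.mem_biUnion hq hzq
      obtain ⟨q, hq, hle⟩ := (Ideal.subset_union_prime_finite hfin (f := id) (⊥ : Ideal R) ⊥
        (fun q hq _ _ => hq.1.1)).mp hsub
      exact hp1_not_le q hq hle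
    -- (v) `x` is a non-zero-divisor (unmixedness)
    have hx0 : x ∈ nonZeroDivisors R := by
      by_contra hx
      have h1 : x ∈ ⋃ p ∈ associatedPrimes R R, (p : Set R) := by
        rw [biUnion_associatedPrimes_eq_compl_nonZeroDivisors]
        exact hx
      obtain ⟨p, hp, hxp⟩ := Set.mem_iUnion₂.mp h1
      exact hxmin p (minimalPrimes_of_mem_associatedPrimes hrs hmem hdim hp) hxp
    have hxreg : IsSMulRegular R x :=
      (isRegular_iff_mem_nonZeroDivisors.mpr hx0).left.isSMulRegular
    -- (vi) `𝔭₀ ∈ Ass R` and `𝔭₁` is minimal over `𝔭₀ + (x)`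
    have hp0ass : s.head.asIdeal ∈ associatedPrimes R R := by
      have h1 := Module.associatedPrimes.minimalPrimes_annihilator_subset_associatedPrimes R R
      rw [Module.annihilator_eq_bot.mpr inferInstance] at h1
      exact h1 hhead
    have hp1min : t.head.asIdeal ∈ (s.head.asIdeal ⊔ Ideal.span {x}).minimalPrimes := by
      refine ⟨⟨t.head.2, sup_le hcov.lt.le ((Ideal.span_singleton_le_iff_mem _).mpr hxp1)⟩, ?_⟩
      rintro q ⟨hqprime, hq⟩ hqle
      have h1 : s.head ≤ ⟨q, hqprime⟩ := (le_sup_left.trans hq : s.head.asIdeal ≤ q)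
      have h2 : (⟨q, hqprime⟩ : PrimeSpectrum R) ≤ t.head := hqle
      rcases h1.eq_or_lt with h3 | h3
      · exfalso
        have hxq : x ∈ q := hq (Ideal.mem_sup_right (Ideal.mem_span_singleton_self x))
        refine hxmin _ hhead ?_
        rw [congrArg PrimeSpectrum.asIdeal h3]
        exact hxq
      · exact (eq_of_le_of_not_lt h2 (hcov.2 h3)).ge
    -- (vii) `𝔭₁ ∈ Ass(R/xⁿR)`
    obtain ⟨n, hn, hp1ass⟩ := exists_mem_associatedPrimes_quotSMulTop_pow hp0ass x hp1min
    set y := x ^ n with hy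
    have hyreg : IsSMulRegular R y := hxreg.pow n
    have hxm : x ∈ maximalIdeal R := IsLocalRing.le_maximalIdeal t.head.2.ne_top hxp1
    have hym : y ∈ maximalIdeal R := Ideal.pow_mem_of_mem _ hxm n hn
    have hyp1 : y ∈ t.head.asIdeal := Ideal.pow_mem_of_mem _ hxp1 n hn
    -- (viii) the ring `S = R/yR`
    obtain ⟨hSnt, hSloc⟩ := isLocalRing_quotient_span_singleton hym
    set S := R ⧸ Ideal.span {y} with hS
    obtain ⟨rs₁, hlen₁, hmem₁, hreg₁⟩ := exists_isRegular_quotSMulTop hrs hmem hyreg hym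
    obtain ⟨hmem₂, hreg₂⟩ := isRegular_quotient_of_isRegular_quotSMulTop hym hreg₁ hmem₁
    set rs₂ := rs₁.map (Ideal.Quotient.mk (Ideal.span {y})) with hrs₂
    have hlen₂ : rs₂.length = d := by rw [hrs₂, List.length_map, hlen₁, hlen]; rfl
    have hdimS : (rs₂.length : WithBot ℕ∞) = ringKrullDim S := by
      obtain ⟨m', hm'⟩ := exists_nat_cast_eq_ringKrullDim (R := S)
      have h1 := ringKrullDim_quotient_span_singleton_succ_eq_ringKrullDim hyreg hym
      rw [← hdim, hlen, hm'] at h1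
      have h2 : m' + 1 = d + 1 := by exact_mod_cast h1
      rw [hm', hlen₂]
      congr 1
      exact_mod_cast (by omega : d = m')
    -- (ix) `𝔭₁/yR` is associated to `S`, hence minimal
    set P₁ : Ideal S := t.head.asIdeal.map (Ideal.Quotient.mk (Ideal.span {y})) with hP₁
    have hP₁ass : P₁ ∈ associatedPrimes S S := map_mem_associatedPrimes_quotient hp1ass
    have hP₁min : P₁ ∈ minimalPrimes S := minimalPrimes_of_mem_associatedPrimes hreg₂ hmem₂ hdimS hP₁ass
    -- (x) transport the tail to `Spec S`
    obtain ⟨F, hF, -, hFc⟩ :=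
      exists_orderEmbedding_of_surjective (Ideal.Quotient.mk (Ideal.span {y})) Ideal.Quotient.mk_surjective
    set P₁' : PrimeSpectrum S := ⟨P₁, hP₁min.1.1⟩ with hP₁'
    have hker : Ideal.span {y} ≤ t.head.asIdeal := (Ideal.span_singleton_le_iff_mem _).mpr hyp1
    have hFP₁ : F P₁' = t.head := by
      rw [hFc]
      ext1
      rw [PrimeSpectrum.comap_asIdeal]
      show Ideal.comap (Ideal.Quotient.mk (Ideal.span {y})) P₁ = t.head.asIdeal
      rw [hP₁, Ideal.comap_map_of_surjective _ Ideal.Quotient.mk_surjective,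
        ← RingHom.ker_eq_comap_bot, Ideal.mk_ker, sup_eq_left.mpr hker]
    have hFtop : F (IsLocalRing.closedPoint S) = IsLocalRing.closedPoint R := by
      rw [hFc]
      ext1
      rw [PrimeSpectrum.comap_asIdeal]
      show (maximalIdeal S).comap (Ideal.Quotient.mk (Ideal.span {y})) = maximalIdeal R
      rw [maximalIdeal_quotient_eq_map (Ideal.span {y}),
        Ideal.comap_map_of_surjective _ Ideal.Quotient.mk_surjective, ← RingHom.ker_eq_comap_bot,
        Ideal.mk_ker, sup_eq_left.mpr ((Ideal.span_singleton_le_iff_mem _).mpr hym)]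
    obtain ⟨t', ht'head, ht'last, ht'len, ht'iff⟩ :=
      exists_ltSeries_lift F hF t (by rw [hFP₁]) (by rw [hFtop, htlast, hlast])
    -- (xi) induction hypothesis in `S`
    have hmin' : t'.head.asIdeal ∈ minimalPrimes S := by rw [ht'head]; exact hP₁min
    have := ih S rs₂ hreg₂ hmem₂ hlen₂ hdimS t' hmin' ht'last (ht'iff.mpr ht)
    omega

variable {R : Type u} [CommRing R] [IsLocalRing R] [IsNoetherianRing R]

/-- In a Noetherian local ring with a regular sequence in `𝔪` of length `dim R` (a Cohen–Macaulay
local ring), every saturated chain of primes from a minimal prime to `𝔪` has length `dim R`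
(Stacks 00N9; Matsumura Thm. 17.4 with Thm. 17.3). [cite: StacksProject, Tag 00N9] -/
theorem length_eq_of_isSaturatedChain_of_isRegular {rs : List R} (hrs : IsRegular R rs)
    (hmem : ∀ r ∈ rs, r ∈ maximalIdeal R) (hdim : (rs.length : WithBot ℕ∞) = ringKrullDim R)
    (s : LTSeries (PrimeSpectrum R)) (hhead : s.head.asIdeal ∈ minimalPrimes R)
    (hlast : s.last = IsLocalRing.closedPoint R) (hs : IsSaturatedChain s) :
    s.length = rs.length :=
  length_eq_of_isSaturatedChain_of_isRegular_aux rs.length R rs hrs hmem rfl hdim s hhead hlast hs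

end Main

/-! ## Regular local rings -/

section Regular

/-- **Matsumura Thm. 17.8 (Stacks 00NQ): a regular local ring has a regular sequence in `𝔪` of
length `dim R`** — by induction on `dim R`: for `x ∈ 𝔪 ∖ 𝔪²`, `x` is a non-zero-divisor
(`R` is a domain) and `R/xR` is regular local of dimension `dim R - 1`.
[cite: Matsumura1987, Thm. 17.8] -/
theorem exists_isRegular_length_eq_ringKrullDim_aux (d : ℕ) :
    ∀ (R : Type u) [CommRing R] [IsRegularLocalRing R], ringKrullDim R = d →
      ∃ rs : List R, IsRegular R rs ∧ (∀ r ∈ rs, r ∈ maximalIdeal R) ∧ rs.length = d := by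
  induction d with
  | zero =>
    intro R _ _ _
    exact ⟨[], IsRegular.nil R R, fun r hr => by simp at hr, rfl⟩
  | succ d ih =>
    intro R _ _ hd
    obtain ⟨x, hxm, hx2⟩ := IsRegularLocalRing.exists_not_mem_sq (R := R)
      (by rw [hd]; exact_mod_cast Nat.succ_ne_zero d)
    obtain ⟨hreg', hdim'⟩ := IsRegularLocalRing.quotient_span_singleton hxm hx2
    set S := R ⧸ Ideal.span {x} with hS
    haveI : IsRegularLocalRing S := hreg'
    have hdS : ringKrullDim S = d := by
      obtain ⟨m', hm'⟩ := exists_nat_cast_eq_ringKrullDim (R := S)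
      rw [hd, hm'] at hdim'
      have h2 : m' + 1 = d + 1 := by exact_mod_cast hdim'
      rw [hm']
      exact_mod_cast (by omega : m' = d)
    obtain ⟨rsS, hregS, hmemS, hlenS⟩ := ih S hdS
    -- lift the sequence to `R`
    set g : S → R := fun z => Classical.choose (Ideal.Quotient.mk_surjective z) with hg
    have hgspec : ∀ z, Ideal.Quotient.mk (Ideal.span {x}) (g z) = z := fun z =>
      Classical.choose_spec (Ideal.Quotient.mk_surjective z)
    set l : List R := rsS.map g with hl
    have hlmap : l.map (Ideal.Quotient.mk (Ideal.span {x})) = rsS := by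
      rw [hl, List.map_map]
      conv_rhs => rw [← List.map_id rsS]
      exact List.map_congr_left fun z _ => hgspec z
    have hlmem : ∀ r ∈ l, r ∈ maximalIdeal R := by
      intro r hr
      obtain ⟨z, hz, rfl⟩ := List.mem_map.mp hr
      have hz' := hmemS z hz
      rw [IsLocalRing.mem_maximalIdeal, mem_nonunits_iff] at hz' ⊢
      intro hu
      apply hz'
      rw [← hgspec z]
      exact hu.map _
    -- `x` is regular on `R` (a domain)
    haveI := isDomain_of_isRegularLocalRing R
    have hx0 : x ≠ 0 := by
      rintro rfl
      exact hx2 (Ideal.zero_mem _)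
    have hxreg : IsSMulRegular R x := fun a b hab => mul_left_cancel₀ hx0 hab
    -- `l` is regular on `R/xR` as an `R`-module
    have heq : (x • (⊤ : Submodule R R)) = Ideal.span {x} := by
      rw [← Submodule.ideal_span_singleton_smul, smul_eq_mul, Ideal.mul_top]
    let e : QuotSMulTop x R ≃ₗ[R] S := Submodule.quotEquivOfEq _ _ heq
    have h1 : IsWeaklyRegular S l := by
      rw [← isWeaklyRegular_map_algebraMap_iff S S l, Ideal.Quotient.algebraMap_eq, hlmap]
      exact hregS.toIsWeaklyRegular
    have h2 : IsWeaklyRegular (QuotSMulTop x R) l := (e.isWeaklyRegular_congr l).mpr h1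
    haveI : Nontrivial (QuotSMulTop x R) := nontrivial_quotSMulTop_of_mem_maximalIdeal R hxm
    have h3 : IsRegular (QuotSMulTop x R) l :=
      IsRegular.of_isWeaklyRegular_of_mem_maximalIdeal (QuotSMulTop x R) hlmem h2
    refine ⟨x :: l, IsRegular.cons hxreg h3, ?_, ?_⟩
    · intro r hr
      rcases List.mem_cons.mp hr with rfl | hr
      · exact hxm
      · exact hlmem r hr
    · rw [List.length_cons, hl, List.length_map, hlenS]

/-- A regular local ring has a regular sequence in `𝔪` of length `dim R` (Matsumura Thm. 17.8:
"a regular local ring is a CM ring"). [cite: Matsumura1987, Thm. 17.8] -/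
theorem exists_isRegular_length_eq_ringKrullDim (R : Type u) [CommRing R] [IsRegularLocalRing R] :
    ∃ rs : List R, IsRegular R rs ∧ (∀ r ∈ rs, r ∈ maximalIdeal R) ∧
      (rs.length : WithBot ℕ∞) = ringKrullDim R := by
  obtain ⟨d, hd⟩ := exists_nat_cast_eq_ringKrullDim (R := R)
  obtain ⟨rs, hrs, hmem, hlen⟩ := exists_isRegular_length_eq_ringKrullDim_aux d R hd
  exact ⟨rs, hrs, hmem, by rw [hd, hlen]⟩

/-- **A regular local ring is catenary** (Matsumura Thm. 17.4 (ii) with Thm. 17.8; Stacks 00NM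
via 00NQ, 00N9): for primes `𝔭₀ ⊆ 𝔮` with `𝔭₀` minimal, the saturated chains from `𝔭₀` to `𝔮`
are the saturated chains from `𝔭₀R_𝔮` to the closed point of the regular local ring `R_𝔮`
(Serre, Matsumura Thm. 19.3), all of length `dim R_𝔮`. [cite: Matsumura1987, Thm. 17.4 (ii)] -/
theorem isCatenaryRing_of_isRegularLocalRing (T : Type u) [CommRing T] [IsRegularLocalRing T] :
    IsCatenaryRing T := by
  refine isCatenaryRing_of_minimalPrimes_clause fun p₀ q hp₀ hp₀q => ?_
  haveI : IsRegularLocalRing (Localization.AtPrime q.asIdeal) :=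
    Matsumura1987_19_3_holds T ‹_› q.asIdeal
  obtain ⟨rs, hrs, hmem, hdim⟩ :=
    exists_isRegular_length_eq_ringKrullDim (Localization.AtPrime q.asIdeal)
  obtain ⟨F, hF, hrange, hFc⟩ :=
    exists_orderEmbedding_of_isLocalization q.asIdeal.primeCompl (Localization.AtPrime q.asIdeal)
  refine ⟨rs.length, fun s hsp hsq hs => ?_⟩
  have hmemF : ∀ z : PrimeSpectrum T, z ≤ q → z ∈ Set.range F := fun z hz => by
    rw [hrange]
    exact Set.disjoint_left.mpr fun a ha haz => (show a ∉ q.asIdeal from ha) (hz haz)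
  obtain ⟨p₀', hp₀'⟩ := hmemF p₀ hp₀q
  have hq' : F (IsLocalRing.closedPoint _) = q := by
    rw [hFc]
    ext1
    exact Localization.AtPrime.under_maximalIdeal (I := q.asIdeal)
  obtain ⟨s', hs'head, hs'last, hs'len, hs'iff⟩ :=
    exists_ltSeries_lift F hF s (by rw [hsp, hp₀']) (by rw [hsq, hq'])
  have hmin' : s'.head.asIdeal ∈ minimalPrimes (Localization.AtPrime q.asIdeal) := by
    rw [hs'head, ← PrimeSpectrum.isMin_iff]
    intro z hz
    have h1 : F z ≤ p₀ := hp₀' ▸ F.monotone hz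
    have h2 : p₀ ≤ F z := (PrimeSpectrum.isMin_iff.mpr hp₀) h1
    rw [← hp₀'] at h2
    exact F.le_iff_le.mp h2
  rw [← hs'len]
  exact length_eq_of_isSaturatedChain_of_isRegular hrs hmem hdim s' hmin' hs'last (hs'iff.mpr hs)

/-- **Regular Noetherian rings are universally catenary** (Stacks 00NM with 00NQ; Matsumura
Thms. 17.8, 17.9; used in Stacks 07QW: "fields, Dedekind rings, and more generally regular rings
are universally catenary"). [cite: StacksProject, Tag 00NM] -/
theorem isUniversallyCatenaryRing_of_isRegularRing' (R : Type u) [CommRing R] [IsRegularRing R] :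
    IsUniversallyCatenaryRing R :=
  isUniversallyCatenaryRing_of_isRegularRing
    (fun T _ hT => by haveI := hT; exact isCatenaryRing_of_isRegularLocalRing T) R

end Regular

end Literature.AlgebraicGeometry.Resolution
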